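import Summits.NavierStokesRegularity.NavierStokesRegularity.Theses.SubcubicESS
import HarnessLib

/-!
# Crux `SubcubicBound` (stmt-NavierStokesRegularity-10671, route SubcubicESS) — the crux SPLITS
# through the critical spacetime `L⁵` norm: `QuinticNormDiscount ∧ QuinticSmoothing → SubcubicBound`

Theorems-only file (no definitions, no named facts).  Closes the glue item `QuinticSplitGlue`
(stmt-NavierStokesRegularity-18399) and records the crux-strategist decomposition (BC2 redirect) of the route's deciding crux X = `Theses.SubcubicESS.SubcubicBound` ("Tao's quantitative
Escauriaza–Seregin–Šverák function is sub-cubic, `F(A) = o(A³)`") into two typed pieces, both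
inlined below exactly as filed on the route:

* **X₁ = `QuinticNormDiscount`.**  For some exponent `a < 9/5` and constant `C`: every Tao-class
  solution on `[0, T]` (`ν = 1`, all Sobolev norms bounded) with `sup_{[0,T]} ‖u‖_{L³} ≤ A`,
  `A ≥ 2`, has `∫_{t/2}^{t} ∫_{ℝ³} |u|⁵ dx ds ≤ C A^{5a}` for every `t ∈ (0, T]`.  The spacetime
  `L⁵` norm on the last half-slab is the symmetric Ladyzhenskaya–Prodi–Serrin quantity; `A^{9/5}`
  is its ENERGY PRICE (the value forced by a cubic velocity bound through
  `∫|u|⁵ ≤ ‖u‖_∞² ∫|u|³`: `F(A)² A³ ln 2` with `F = A³`).  X₁ says the `L⁵` activity of critically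
  bounded solutions is strictly cheaper than that.  It is implied by ANY polynomial sub-cubic ESS
  bound `|u| ≤ C A^k t^{-1/2}`, `k < 3` (theorem
  `subcubicESS_quinticNormDiscount_of_polynomialBound` below, `a = (2k⁺+3)/5`), but not by X itself
  (`o(A³)` only gives the price `9/5`).
* **X₂ = `QuinticSmoothing`.**  For some `c > 0`, `b` with `b + (9/5) c ≤ 3` and a constant `C`:
  `√t |u(t, x)| ≤ C A^b (1 + B)^c` whenever additionally `∫_{t/2}^{t} ∫ |u|⁵ ≤ B⁵`.  This is the
  polynomial form of the quantitative LPS smoothing `‖u‖_{L^∞(ℝ³ × (½,1))} ≤ G(‖u‖_{L⁵})` that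
  Barker–Prange single out (arXiv:2003.06717, §1.2.2: known `G(x) ∼ exp(O(1) x⁵)` by the
  enstrophy–Gronwall argument; "being able to substantially improve upon `G(x) ∼ exp(O(1)x⁵)` would
  most likely require the utilization of a nonlinear mechanism that reduces the influence of the
  vortex stretching term"), with the `L³` level `A` as a second parameter and the exponents placed
  ON OR INSIDE THE ENERGY LINE `b + (9/5) c = 3`.

## Why this seam (and why neither piece is the summit in disguise)

The energy of a finite-energy solution pays for exactly three powers of the `L³`-amplitude
(`‖u‖₃³ ≤ ‖u‖₂² ‖u‖_∞`, the route's `EnergyBridge`) and, by the same Hölder line integrated in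
time, for `5/3` powers of the `L⁵`-amplitude.  A mixed polynomial bound `√t|u| ≤ C A^b (1+B)^c`
therefore closes a DOUBLE bridge — and would imply `NoBlowup` on its own — exactly when
`b + (9/5) c < 3` (from `A³ ≲ A^b B^c` and `B⁵ ≲ A^{2b+3} B^{2c}`: both can diverge iff
`3 ≤ b + (9/5)c`).  X₂ is stated on the closed side `≤ 3` with `c > 0`; since the bound is monotone
in `(b, c)` (`A ≥ 2`, `1 + B ≥ 1`), every witness may be pushed up-right ONTO the line
`b + (9/5)c = 3`, where the exponents balance exactly and no bridge closes: X₂ alone decides nothing.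
X₁ alone gives `B ≤ C A^a`, after which only the known `exp(O(1)B⁵)` smoothing is available: no
bridge either.  Together: `F(A) := C₂ A^b (1 + (|C₁| A^{5a⁺})^{1/5})^c = O(A^{b + a⁺c})` and
`b + a⁺c < b + (9/5)c ≤ 3` because `c > 0` and `a⁺ = max(a,0) < 9/5` — the assembly
`subcubicESS_subcubicBound_of_quintic` is this exponent bookkeeping (real-power asymptotics), not
a one-line seam.  (The naive cut "X₁ at the forced price `9/5`, X₂ with the open budget `< 3`" was
rejected precisely because its X₂ closes the double bridge alone.)

## References

* T. Tao, arXiv:1908.04958, Thm. 1.2, Rmk. 1.5 (the shape of X; triple-exponential `F`).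
  [Tao2021QuantitativeNS]
* T. Barker, C. Prange, Comm. Math. Phys. 385 (2021) = arXiv:2003.06717, §1.2.2 pp. 7–8 (the
  quantitative `L⁵` smoothing `G(x) ∼ exp(O(1)x⁵)`, linear `G` for small `L⁵`). [BarkerPrange2021CMP]
* L. Escauriaza, G. Seregin, V. Šverák, Russ. Math. Surveys 58 (2003) (the qualitative endpoint).
-/

noncomputable section

-- the sub-problem namespace repeats the summit name (D-0017 layout `Summit.<S>.<P>.Theorems`)
set_option linter.dupNamespace false

namespace Summit.NavierStokesRegularity.NavierStokesRegularity.Theorems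

open MeasureTheory Set Function Filter Topology
open Literature.Analysis.FluidPDE
open scoped ENNReal NNReal

/-! ### Elementary real-power asymptotics -/

/-- `K A^σ ≤ ε A³` for all large `A` when `σ < 3` (`A₀ = max(1, (K/ε)^{1/(3-σ)})`). [folklore] -/
theorem subcubicESS_eventually_rpow_le_eps_cube {K σ ε : ℝ} (hσ : σ < 3) (hε : 0 < ε) :
    ∃ A₀ : ℝ, ∀ A : ℝ, A₀ ≤ A → K * A ^ σ ≤ ε * A ^ 3 := by
  by_cases hK : K ≤ 0
  · refine ⟨1, fun A hA => ?_⟩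
    have hA0 : 0 < A := one_pos.trans_le hA
    have h1 : K * A ^ σ ≤ 0 := mul_nonpos_of_nonpos_of_nonneg hK (Real.rpow_nonneg hA0.le _)
    exact h1.trans (by positivity)
  push Not at hK
  have h3σ : 0 < 3 - σ := by linarith
  refine ⟨max 1 ((K / ε) ^ (1 / (3 - σ))), fun A hA => ?_⟩
  have hA1 : 1 ≤ A := (le_max_left _ _).trans hA
  have hA0 : 0 < A := one_pos.trans_le hA1
  have hKε : 0 < K / ε := div_pos hK hε
  have hpow : K / ε ≤ A ^ (3 - σ) := by
    have h := (le_max_right _ _).trans hA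
    have h' : ((K / ε) ^ (1 / (3 - σ))) ^ (3 - σ) ≤ A ^ (3 - σ) :=
      Real.rpow_le_rpow (Real.rpow_nonneg hKε.le _) h h3σ.le
    rwa [← Real.rpow_mul hKε.le, one_div_mul_cancel h3σ.ne', Real.rpow_one] at h'
  have hsplit : A ^ (3 : ℝ) = A ^ σ * A ^ (3 - σ) := by
    rw [← Real.rpow_add hA0]; ring_nf
  have hA3 : A ^ (3 : ℕ) = A ^ (3 : ℝ) := by
    rw [← Real.rpow_natCast]; norm_num
  rw [hA3, hsplit]
  have hσpos : 0 < A ^ σ := Real.rpow_pos_of_pos hA0 _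
  calc K * A ^ σ = (K / ε) * ε * A ^ σ := by field_simp
    _ ≤ A ^ (3 - σ) * ε * A ^ σ := by gcongr
    _ = ε * (A ^ σ * A ^ (3 - σ)) := by ring

/-! ### The assembly `X₁ → X₂ → X` -/

/-- **Assembly of the split** (`QuinticNormDiscount → QuinticSmoothing → SubcubicBound`, the two
pieces inlined verbatim).  From X₁ take `(C₁, a)` and put `a⁺ := max(a, 0) < 9/5`,
`B(A) := (|C₁| A^{5a⁺})^{1/5}` (so `∫_{t/2}^t∫|u|⁵ ≤ C₁A^{5a} ≤ |C₁|A^{5a⁺} = B(A)⁵` for `A ≥ 1`);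
from X₂ take `(C₂, b, c)` and put `F(A) := C₂ A^b (1 + B(A))^c`.  The velocity clause of
`SubcubicBound` is X₂ at level `B(A)`; the `o(A³)` clause: for `A ≥ 1`,
`1 + B(A) ≤ 2 max(1,|C₁|^{1/5}) A^{a⁺}`, so `F(A) ≤ K A^{b + a⁺c}` with
`b + a⁺c < b + (9/5)c ≤ 3` (`c > 0`), and `K A^σ ≤ εA³` eventually for `σ < 3`.
[cite: BarkerPrange2021CMP, §1.2.2; Tao2021QuantitativeNS, Thm. 1.2] -/
theorem subcubicESS_subcubicBound_of_quintic
    (h₁ : ∃ C a : ℝ, a < 9 / 5 ∧ ∀ (T A : ℝ) (u : ℝ → EuclideanSpace ℝ (Fin 3) → EuclideanSpace ℝ (Fin 3)) (p : ℝ → EuclideanSpace ℝ (Fin 3) → ℝ), (Literature.Analysis.FluidPDE.IsClassicalNSSolutionOn (Set.Icc 0 T) 1 0 u p ∧ ∀ n : ℕ, ∃ C : NNReal, ∀ t ∈ Set.Icc 0 T, MeasureTheory.eLpNorm (iteratedFDeriv ℝ n (u t)) 2 MeasureTheory.volume ≤ C) → (∀ t ∈ Set.Icc 0 T, MeasureTheory.eLpNorm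 (u t) 3 MeasureTheory.volume ≤ ENNReal.ofReal A) → 2 ≤ A → ∀ t ∈ Set.Ioc 0 T, ∫⁻ s in Set.Icc (t / 2) t, ∫⁻ x : EuclideanSpace ℝ (Fin 3), ‖u s x‖ₑ ^ (5 : ℕ) ≤ ENNReal.ofReal (C * A ^ (5 * a)))
    (h₂ : ∃ C b c : ℝ, 0 < c ∧ b + 9 / 5 * c ≤ 3 ∧ ∀ (T A B : ℝ) (u : ℝ → EuclideanSpace ℝ (Fin 3) → EuclideanSpace ℝ (Fin 3)) (p : ℝ → EuclideanSpace ℝ (Fin 3) → ℝ), (Literature.Analysis.FluidPDE.IsClassicalNSSolutionOn (Set.Icc 0 T) 1 0 u p ∧ ∀ n : ℕ, ∃ C : NNReal, ∀ t ∈ Set.Icc 0 T, MeasureTheory.eLpNorm (iteratedFDeriv ℝ n (u t)) 2 MeasureTheory.volume ≤ C) → (∀ t ∈ Set.Icc 0 T, MeasureTheory.eLpNorm (u t) 3 MeasureTheory.volume ≤ ENNReal.ofReal A) → 2 ≤ A → 0 ≤ B → ∀ t ∈ Set.Ioc 0 T, (∫⁻ s in Set.Icc (t / 2) t, ∫⁻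 x : EuclideanSpace ℝ (Fin 3), ‖u s x‖ₑ ^ (5 : ℕ)) ≤ ENNReal.ofReal (B ^ 5) → ∀ x : EuclideanSpace ℝ (Fin 3), ‖u t x‖ ≤ C * A ^ b * (1 + B) ^ c * t ^ (-(1 / 2 : ℝ))) :
    Theses.SubcubicESS.SubcubicBound := by
  obtain ⟨C₁, a, ha, h₁⟩ := h₁
  obtain ⟨C₂, b, c, hc0, hbc, h₂⟩ := h₂
  -- nonnegative part of the discount exponent
  set a' : ℝ := max a 0 with ha'def
  have ha'0 : 0 ≤ a' := le_max_right _ _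
  have ha'95 : a' < 9 / 5 := max_lt ha (by norm_num)
  -- the `L⁵` level supplied by X₁: B(A) := (|C₁| A^{5a'})^{1/5}
  set B : ℝ → ℝ := fun A => (|C₁| * A ^ (5 * a')) ^ (1 / 5 : ℝ) with hBdef
  have hB0 : ∀ A, 0 ≤ A → 0 ≤ B A := fun A hA =>
    Real.rpow_nonneg (mul_nonneg (abs_nonneg _) (Real.rpow_nonneg hA _)) _
  have hB5 : ∀ A, 0 ≤ A → B A ^ 5 = |C₁| * A ^ (5 * a') := fun A hA => by
    have h0 : 0 ≤ |C₁| * A ^ (5 * a') := mul_nonneg (abs_nonneg _) (Real.rpow_nonneg hA _)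
    simp only [hBdef]
    rw [← Real.rpow_natCast, ← Real.rpow_mul h0]
    norm_num
  refine ⟨fun A => C₂ * A ^ b * (1 + B A) ^ c, ?_, ?_⟩
  · -- the o(A³) clause: F(A) ≤ C₂⁺ (2 max(1,|C₁|^{1/5}))^c A^{b + a' c} and b + a' c < 3
    intro ε hε
    have hσ : b + a' * c < 3 := by nlinarith
    set M : ℝ := max 1 (|C₁| ^ (1 / 5 : ℝ)) with hMdef
    have hM1 : 1 ≤ M := le_max_left _ _
    set K : ℝ := max C₂ 0 * (2 * M) ^ c with hKdef
    obtain ⟨A₀, hA₀⟩ := subcubicESS_eventually_rpow_le_eps_cube (K := K) hσ hε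
    refine ⟨max 1 A₀, fun A hA => ?_⟩
    have hA1 : 1 ≤ A := (le_max_left _ _).trans hA
    have hA0 : 0 < A := one_pos.trans_le hA1
    have hAA₀ : A₀ ≤ A := (le_max_right _ _).trans hA
    have hBA : B A = |C₁| ^ (1 / 5 : ℝ) * A ^ a' := by
      simp only [hBdef]
      rw [Real.mul_rpow (abs_nonneg _) (Real.rpow_nonneg hA0.le _), ← Real.rpow_mul hA0.le]
      congr 1
      ring_nf
    have hAa : 1 ≤ A ^ a' := Real.one_le_rpow hA1 ha'0
    have h1B : 1 + B A ≤ 2 * M * A ^ a' := by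
      rw [hBA]
      have h1 : (1 : ℝ) ≤ M * A ^ a' := by nlinarith
      have h2 : |C₁| ^ (1 / 5 : ℝ) * A ^ a' ≤ M * A ^ a' := by
        gcongr; exact le_max_right _ _
      linarith
    have h1B0 : 0 ≤ 1 + B A := by linarith [hB0 A hA0.le]
    have hpowc : (1 + B A) ^ c ≤ (2 * M) ^ c * A ^ (a' * c) := by
      calc (1 + B A) ^ c ≤ (2 * M * A ^ a') ^ c := Real.rpow_le_rpow h1B0 h1B hc0.le
        _ = (2 * M) ^ c * (A ^ a') ^ c :=
            Real.mul_rpow (by positivity) (Real.rpow_nonneg hA0.le _)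
        _ = (2 * M) ^ c * A ^ (a' * c) := by rw [← Real.rpow_mul hA0.le]
    have hFK : C₂ * A ^ b * (1 + B A) ^ c ≤ K * A ^ (b + a' * c) := by
      have hAb : 0 ≤ A ^ b := Real.rpow_nonneg hA0.le _
      calc C₂ * A ^ b * (1 + B A) ^ c ≤ max C₂ 0 * A ^ b * (1 + B A) ^ c := by
            gcongr
            · exact le_max_left _ _
        _ ≤ max C₂ 0 * A ^ b * ((2 * M) ^ c * A ^ (a' * c)) := by
            gcongr
        _ = K * (A ^ b * A ^ (a' * c)) := by simp only [hKdef]; ring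
        _ = K * A ^ (b + a' * c) := by rw [← Real.rpow_add hA0]
    exact hFK.trans (hA₀ A hAA₀)
  · -- the velocity clause: X₁ gives the `L⁵` level `B A`, X₂ the bound
    intro T A u p hcl hL3 hA t ht x
    have hA1 : 1 ≤ A := one_le_two.trans hA
    have hA0 : 0 ≤ A := zero_le_one.trans hA1
    have hq := h₁ T A u p hcl hL3 hA t ht
    have hq' : (∫⁻ s in Set.Icc (t / 2) t, ∫⁻ y : EuclideanSpace ℝ (Fin 3), ‖u s y‖ₑ ^ (5 : ℕ))
        ≤ ENNReal.ofReal (B A ^ 5) := by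
      refine hq.trans (ENNReal.ofReal_le_ofReal ?_)
      rw [hB5 A hA0]
      calc C₁ * A ^ (5 * a) ≤ |C₁| * A ^ (5 * a) :=
            mul_le_mul_of_nonneg_right (le_abs_self _) (Real.rpow_nonneg hA0 _)
        _ ≤ |C₁| * A ^ (5 * a') := by
            gcongr
            · exact le_max_left _ _
    exact h₂ T A (B A) u p hcl hL3 hA (hB0 A hA0) t ht hq' x

/-! ### X₁ is implied by any polynomial sub-cubic ESS bound -/

/-- **`L⁵` shadow of a pointwise bound** (Hölder against `L³`, integrated over the half-slab):
if `‖u(s, x)‖ ≤ m` for `s ∈ [t/2, t]` (`m ≥ 0`) and `‖u(s)‖_{L³} ≤ A` there (`A ≥ 0`), then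
`∫_{t/2}^t ∫ |u|⁵ ≤ m² A³ (t/2)` — in the root-free `lintegral` form
`∫⁻∫⁻ ‖u‖ₑ⁵ ≤ ofReal (m² A³ (t/2))`.  Proof: `|u|⁵ ≤ m² |u|³` pointwise, `∫|u(s)|³ = ‖u(s)‖₃³`,
and the time integral of a constant over `[t/2, t]`. [folklore] -/
theorem subcubicESS_lintegral_quintic_le {t A m : ℝ} (hA : 0 ≤ A) (hm : 0 ≤ m)
    {u : ℝ → EuclideanSpace ℝ (Fin 3) → EuclideanSpace ℝ (Fin 3)}
    (hbd : ∀ s ∈ Set.Icc (t / 2) t, ∀ x, ‖u s x‖ ≤ m)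
    (hL3 : ∀ s ∈ Set.Icc (t / 2) t, eLpNorm (u s) 3 volume ≤ ENNReal.ofReal A) :
    ∫⁻ s in Set.Icc (t / 2) t, ∫⁻ x : EuclideanSpace ℝ (Fin 3), ‖u s x‖ₑ ^ (5 : ℕ)
      ≤ ENNReal.ofReal (m ^ 2 * A ^ 3 * (t / 2)) := by
  -- slice bound
  have hslice : ∀ s ∈ Set.Icc (t / 2) t,
      ∫⁻ x : EuclideanSpace ℝ (Fin 3), ‖u s x‖ₑ ^ (5 : ℕ) ≤ ENNReal.ofReal (m ^ 2 * A ^ 3) := by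
    intro s hs
    have h3 := eLpNorm_nnreal_pow_eq_lintegral (f := u s) (μ := volume) (p := (3 : ℝ≥0))
      three_ne_zero
    simp only [ENNReal.coe_ofNat, NNReal.coe_ofNat, ENNReal.rpow_ofNat] at h3
    have hpt : ∀ x, ‖u s x‖ₑ ^ (5 : ℕ) ≤ ENNReal.ofReal (m ^ 2) * ‖u s x‖ₑ ^ 3 := fun x => by
      have h' : ‖u s x‖ₑ ^ (5 : ℕ) = ‖u s x‖ₑ ^ 2 * ‖u s x‖ₑ ^ 3 := by ring
      rw [h', ENNReal.ofReal_pow hm 2]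
      gcongr
      rw [← ofReal_norm]
      exact ENNReal.ofReal_le_ofReal (hbd s hs x)
    calc ∫⁻ x, ‖u s x‖ₑ ^ (5 : ℕ) ≤ ∫⁻ x, ENNReal.ofReal (m ^ 2) * ‖u s x‖ₑ ^ 3 := lintegral_mono hpt
      _ = ENNReal.ofReal (m ^ 2) * ∫⁻ x, ‖u s x‖ₑ ^ 3 :=
          lintegral_const_mul' _ _ ENNReal.ofReal_ne_top
      _ = ENNReal.ofReal (m ^ 2) * eLpNorm (u s) 3 volume ^ 3 := by rw [h3]
      _ ≤ ENNReal.ofReal (m ^ 2) * ENNReal.ofReal A ^ 3 := by gcongr; exact hL3 s hs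
      _ = ENNReal.ofReal (m ^ 2 * A ^ 3) := by
          rw [← ENNReal.ofReal_pow hA 3, ← ENNReal.ofReal_mul (sq_nonneg m)]
  calc ∫⁻ s in Set.Icc (t / 2) t, ∫⁻ x : EuclideanSpace ℝ (Fin 3), ‖u s x‖ₑ ^ (5 : ℕ)
      ≤ ∫⁻ s in Set.Icc (t / 2) t, ENNReal.ofReal (m ^ 2 * A ^ 3) :=
        setLIntegral_mono' measurableSet_Icc fun s hs => hslice s hs
    _ = ENNReal.ofReal (m ^ 2 * A ^ 3) * volume (Set.Icc (t / 2) t) := setLIntegral_const _ _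
    _ = ENNReal.ofReal (m ^ 2 * A ^ 3) * ENNReal.ofReal (t - t / 2) := by rw [Real.volume_Icc]
    _ = ENNReal.ofReal (m ^ 2 * A ^ 3 * (t / 2)) := by
        rw [← ENNReal.ofReal_mul (by positivity)]
        ring_nf

/-- **X₁ is no stronger than a polynomial sub-cubic ESS bound.**  If Tao's quantitative ESS
function is bounded by `C A^k` with `k < 3` (the polynomial strengthening of the thesis X that the
route's rung `PolynomialBound` aims at, with exponent below the cubic threshold), then
`QuinticNormDiscount` holds with `a = (2k⁺ + 3)/5 < 9/5`: on `[t/2, t]`,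
`|u(s,x)| ≤ C⁺A^{k⁺}s^{-1/2} ≤ C⁺A^{k⁺}(t/2)^{-1/2}`, so by `subcubicESS_lintegral_quintic_le`
`∫_{t/2}^t∫|u|⁵ ≤ (C⁺)² A^{2k⁺} (2/t) A³ (t/2) = (C⁺)² A^{2k⁺+3}`. [folklore] -/
theorem subcubicESS_quinticNormDiscount_of_polynomialBound
    (hP : ∃ C k : ℝ, k < 3 ∧ ∀ (T A : ℝ) (u : ℝ → EuclideanSpace ℝ (Fin 3) → EuclideanSpace ℝ (Fin 3)) (p : ℝ → EuclideanSpace ℝ (Fin 3) → ℝ), (Literature.Analysis.FluidPDE.IsClassicalNSSolutionOn (Set.Icc 0 T) 1 0 u p ∧ ∀ n : ℕ, ∃ C : NNReal, ∀ t ∈ Set.Icc 0 T, MeasureTheory.eLpNorm (iteratedFDeriv ℝ n (u t)) 2 MeasureTheory.volume ≤ C) → (∀ t ∈ Set.Icc 0 T, MeasureTheory.eLpNorm (u t) 3 MeasureTheory.volume ≤ ENNReal.ofReal A) → 2 ≤ A → ∀ t ∈ Set.Ioc 0 T, ∀ x : EuclideanSpace ℝ (Fin 3), ‖u t x‖ ≤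 C * A ^ k * t ^ (-(1 / 2 : ℝ))) :
    ∃ C a : ℝ, a < 9 / 5 ∧ ∀ (T A : ℝ) (u : ℝ → EuclideanSpace ℝ (Fin 3) → EuclideanSpace ℝ (Fin 3)) (p : ℝ → EuclideanSpace ℝ (Fin 3) → ℝ), (Literature.Analysis.FluidPDE.IsClassicalNSSolutionOn (Set.Icc 0 T) 1 0 u p ∧ ∀ n : ℕ, ∃ C : NNReal, ∀ t ∈ Set.Icc 0 T, MeasureTheory.eLpNorm (iteratedFDeriv ℝ n (u t)) 2 MeasureTheory.volume ≤ C) → (∀ t ∈ Set.Icc 0 T, MeasureTheory.eLpNorm (u t) 3 MeasureTheory.volume ≤ ENNReal.ofReal A) → 2 ≤ A → ∀ t ∈ Set.Ioc 0 T, ∫⁻ s in Set.Icc (t / 2) t, ∫⁻ x : EuclideanSpace ℝ (Fin 3), ‖u s x‖ₑ ^ (5 : ℕ) ≤ ENNReal.ofReal (C * A ^ (5 * a)) := by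
  obtain ⟨C, k, hk, hP⟩ := hP
  set k' : ℝ := max k 0 with hk'def
  have hk'0 : 0 ≤ k' := le_max_right _ _
  have hk'3 : k' < 3 := max_lt hk (by norm_num)
  set C' : ℝ := max C 0 with hC'def
  have hC'0 : 0 ≤ C' := le_max_right _ _
  refine ⟨C' ^ 2, (2 * k' + 3) / 5, by linarith, ?_⟩
  intro T A u p hcl hL3 hA t ht
  have hA1 : 1 ≤ A := one_le_two.trans hA
  have hA0 : 0 < A := one_pos.trans_le hA1
  have ht0 : 0 < t := ht.1
  -- the pointwise bound on the half-slab: m := C' A^{k'} (t/2)^{-1/2}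
  set m : ℝ := C' * A ^ k' * (t / 2) ^ (-(1 / 2 : ℝ)) with hmdef
  have hm0 : 0 ≤ m := by positivity
  have hbd : ∀ s ∈ Set.Icc (t / 2) t, ∀ x, ‖u s x‖ ≤ m := by
    intro s hs x
    have hs0 : 0 < s := (half_pos ht0).trans_le hs.1
    have hsT : s ∈ Set.Ioc 0 T := ⟨hs0, hs.2.trans ht.2⟩
    have h1 := hP T A u p hcl hL3 hA s hsT x
    have hAk : A ^ k ≤ A ^ k' := Real.rpow_le_rpow_of_exponent_le hA1 (le_max_left _ _)
    have hst : s ^ (-(1 / 2 : ℝ)) ≤ (t / 2) ^ (-(1 / 2 : ℝ)) :=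
      Real.rpow_le_rpow_of_nonpos (half_pos ht0) hs.1 (by norm_num)
    calc ‖u s x‖ ≤ C * A ^ k * s ^ (-(1 / 2 : ℝ)) := h1
      _ ≤ C' * A ^ k' * s ^ (-(1 / 2 : ℝ)) := by
          have hs' : 0 ≤ s ^ (-(1 / 2 : ℝ)) := Real.rpow_nonneg hs0.le _
          apply mul_le_mul_of_nonneg_right _ hs'
          calc C * A ^ k ≤ C' * A ^ k :=
                mul_le_mul_of_nonneg_right (le_max_left _ _) (Real.rpow_nonneg hA0.le _)
            _ ≤ C' * A ^ k' := mul_le_mul_of_nonneg_left hAk hC'0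
      _ ≤ C' * A ^ k' * (t / 2) ^ (-(1 / 2 : ℝ)) := by
          apply mul_le_mul_of_nonneg_left hst
          positivity
  have hL3' : ∀ s ∈ Set.Icc (t / 2) t, eLpNorm (u s) 3 volume ≤ ENNReal.ofReal A := fun s hs =>
    hL3 s ⟨((half_pos ht0).trans_le hs.1).le, hs.2.trans ht.2⟩
  refine (subcubicESS_lintegral_quintic_le hA0.le hm0 hbd hL3').trans
    (ENNReal.ofReal_le_ofReal (le_of_eq ?_))
  -- m² A³ (t/2) = C'² A^{2k'+3}
  have hhalf : ((t / 2) ^ (-(1 / 2 : ℝ))) ^ 2 * (t / 2) = 1 := by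
    rw [← Real.rpow_natCast, ← Real.rpow_mul (half_pos ht0).le]
    norm_num
    rw [Real.rpow_neg (half_pos ht0).le, Real.rpow_one, inv_mul_cancel₀ (half_pos ht0).ne']
  have hApow : (A ^ k') ^ 2 * A ^ (3 : ℕ) = A ^ (5 * ((2 * k' + 3) / 5)) := by
    rw [← Real.rpow_natCast (A ^ k'), ← Real.rpow_mul hA0.le, ← Real.rpow_natCast A,
      ← Real.rpow_add hA0]
    congr 1
    push_cast
    ring
  calc m ^ 2 * A ^ 3 * (t / 2)
      = C' ^ 2 * ((A ^ k') ^ 2 * A ^ (3 : ℕ)) * (((t / 2) ^ (-(1 / 2 : ℝ))) ^ 2 * (t / 2)) := by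
        simp only [hmdef]; ring
    _ = C' ^ 2 * A ^ (5 * ((2 * k' + 3) / 5)) := by rw [hhalf, hApow, mul_one]

/-! ### The glue item by name (requires route file rev ≥ 5) -/

/-- **`QuinticSplitGlue` (item stmt-NavierStokesRegularity-18399 of route SubcubicESS)**, by item name:
the two route decls unfold definitionally to the inlined hypotheses of
`subcubicESS_subcubicBound_of_quintic`. [folklore] -/
theorem subcubicESS_quinticSplitGlue_proof : Theses.SubcubicESS.QuinticSplitGlue :=
  fun h₁ h₂ => subcubicESS_subcubicBound_of_quintic h₁ h₂

end Summit.NavierStokesRegularity.NavierStokesRegularity.Theorems
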